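import Summits.CriticalPhenomena.PercolationContinuityZ3.Theorems.PercNearOneGluingNoHeavyQuantChemicalRadiusCritical
import Mathlib.Analysis.PSeries
import HarnessLib

/-!
# THE NEAR-CRITICAL CHEMICAL RADIUS: `E_{p_c}[Rad_int(C(0))] = ∞` in every `d ≥ 2`; the subcritical exponential form
# `P_p(Rad_int ≥ r) ≥ e^{−r(p_c−p)/p}/(e(r+3))` ("`ν_int ≥ 1`"); supercritical lower bounds in every `d`; and the LINEAR chemical
# window in high dimensions: `P_{p_c+s}(Rad_int(C(0)) ≥ r) ≍ max(1/r, s)` — quant lane, seat p4 gen 38, file 5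

builds on p205010 (kernel theorem, internal audit signed; external expert review pending) — NOT used in this file.
Seat `prim-quant-p4`, `--supports stmt-CriticalPhenomena-4575`; pure proofs, no definitions.

Sequel of `…QuantChemicalRadiusCritical` (file 3: `P_{p_c}(far r) ≥ 1/(e(r+3))`, `θ(p) ≤ (p/p_c)^r P_{p_c}(far r)`, `P_{p_c}(far r) ≤ C/r`
under the triangle condition), with `far r = Chemical.far (zdGraph d) 0 r = {Rad_int(C(0)) ≥ r}`, `p_c = criticalProbI d`.

* §1 **`ChemRad.not_summable_real_far_criticalProbI`** — every `d ≥ 2`: `Σ_r P_{p_c}(Rad_int(C(0)) ≥ r) = ∞`, i.e. THE CRITICAL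
  CLUSTER HAS INFINITE EXPECTED INTRINSIC RADIUS (stronger than Aizenman–Newman's `E_{p_c}|C| = ∞`, since `|C| ≥ Rad_int`); no hypothesis.
* §2 **`ChemRad.real_far_subcritical_ge_exp`** — every `d ≥ 2`, `0 < p ≤ p_c`: `P_p(Rad_int ≥ r) ≥ e^{−r(p_c−p)/p}/(e(r+3))`
  (Hutchcroft's Prop. 4.2 form); so the subcritical chemical radius tail decays no faster than `e^{−r(p_c−p)/p}`: the INTRINSIC
  correlation length is `≥ p/(p_c−p)` ("`ν_int ≥ 1`", mean-field sharp: `ν_int = 2ν = 1`).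
* §3 **`ChemRad.real_far_ge_of_ge_criticalProbI`** — every `d ≥ 2`, `p_c ≤ p < 1`: `P_p(Rad_int ≥ r) ≥ (1−p)/(e(r+3))` and
  `≥ θ(p) ≥ (p−p_c)/(p(1−p_c))`, hence **`ChemRad.real_far_supercrit_ge_max`**: `P_p(Rad_int ≥ r) ≥ ((1−p)/(4e))·max(1/r, p−p_c)` (`r ≥ 1`).
* §4 **`ChemRad.real_far_supercrit_le_max_of_triangle`**, **`ChemRad.real_far_supercrit_two_sided_of_triangle`**, **`…_high_dim`** —
  under the triangle condition (tree theorem for `d ≥ D`): `P_p(Rad_int(C(0)) ≥ r) ≤ C'·max(1/r, p−p_c)` for all `p ≥ p_c`, `r ≥ 1`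
  (`C' = max(e²C,1)/p_c`; Hutchcroft's Lemma 2.1, first bound, on `ℤ^d`), so **`P_{p_c+s}(Rad_int ≥ r) ≍ max(1/r, s)`**: the chemical
  one-arm crosses over from `1/r` to `θ ≍ s` at the LINEAR scale `r ≍ 1/(p−p_c)` (the volume window of gen 37 is parabolic,
  `k(p−p_c)² ≍ 1`; mean field: chemical distance `≍ (extrinsic distance)²`).

HONEST STATUS.  §1–§3 hypothesis-free and elementary on file 3 (§2 = Hutchcroft 2022 Prop. 4.2's printed form with explicit constants;
§1 not located in print for general `d`, immediate from it); §4 = Hutchcroft 2022 Lemma 2.1 (radius part) transplanted to `ℤ^d` under the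
triangle condition, two-sided form NEW AS TYPED (elementary).  The truncated event `{r ≤ Rad_int < ∞}` above `p_c` (Hutchcroft's Thm 1.2
on nonamenable graphs) is NOT treated — on `ℤ^d` it is open in print.  NO rate, NO exponent for `d = 3`; (T1)/(T2) and the lane's honest
sentence UNCHANGED.

References: T. Hutchcroft, Proc. Lond. Math. Soc. 125 (2022), arXiv:2002.02916, Lemma 2.1, Prop. 4.2, §5 [Hutchcroft2022SlightlySupercritical];
G. Kozma, A. Nachmias, Invent. Math. 178 (2009) Thm 1.2 [KozmaNachmias2009]; M. Aizenman, C. M. Newman, J. Stat. Phys. 36 (1984)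
(`χ(p_c) = ∞`) [AizenmanNewman1984].
-/

noncomputable section

namespace Summit.CriticalPhenomena.PercolationContinuityZ3.Theorems

open MeasureTheory Set Filter Topology Literature.Probability.Percolation Literature.Probability.LatticeModels
open Literature.Probability.Percolation.Chemical
open scoped Classical

namespace ChemRad

variable {d : ℕ}

/-! ### §1. `E_{p_c}[Rad_int(C(0))] = ∞` in every dimension -/

/-- **THE CRITICAL CLUSTER HAS INFINITE EXPECTED INTRINSIC RADIUS, every `d ≥ 2`**: the series `Σ_r P_{p_c}(Rad_int(C(0)) ≥ r)`
(`= E_{p_c}[Rad_int(C(0)) + 1]` by the layer-cake formula) diverges, by comparison with `Σ 1/(e(r+3))`.  No hypothesis.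
[cite: Hutchcroft2022SlightlySupercritical, Prop. 4.2] -/
theorem not_summable_real_far_criticalProbI (hd : 2 ≤ d) :
    ¬ Summable (fun r : ℕ => (bondPercolation (zdGraph d) (criticalProbI d)).real (far (zdGraph d) (0 : Site d) r)) := by
  intro hsum
  have hcmp : Summable (fun r : ℕ => 1 / (Real.exp 1 * ((r : ℝ) + 3))) :=
    Summable.of_nonneg_of_le (fun r => by positivity) (fun r => real_far_criticalProbI_ge hd r) hsum
  have h3 : Summable (fun r : ℕ => 1 / (((r + 3 : ℕ) : ℝ))) := by
    have := hcmp.mul_left (Real.exp 1)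
    refine this.congr fun r => ?_
    push_cast
    field_simp
  exact Real.not_summable_one_div_natCast ((summable_nat_add_iff 3).1 h3)

/-! ### §2. Below `p_c`: the exponential form (`ν_int ≥ 1`) -/

/-- `(p/p_c)^r ≥ exp(−r (p_c − p)/p)` for `0 < p ≤ p_c` (`log(p_c/p) ≤ p_c/p − 1`). [folklore] -/
theorem exp_neg_le_div_pow {p pc : ℝ} (hp0 : 0 < p) (hppc : p ≤ pc) (r : ℕ) :
    Real.exp (-(r * ((pc - p) / p))) ≤ (p / pc) ^ r := by
  have hpc0 : 0 < pc := hp0.trans_le hppc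
  rw [← Real.exp_log (pow_pos (div_pos hp0 hpc0) r), Real.exp_le_exp, Real.log_pow, Real.log_div hp0.ne' hpc0.ne']
  have hlog : Real.log pc - Real.log p ≤ (pc - p) / p := by
    rw [← Real.log_div hpc0.ne' hp0.ne']
    have := Real.log_le_sub_one_of_pos (div_pos hpc0 hp0)
    rw [div_sub_one hp0.ne'] at this
    exact this
  have hr : (0 : ℝ) ≤ r := Nat.cast_nonneg r
  nlinarith

/-- **SUBCRITICAL EXPONENTIAL FORM, every `d ≥ 2`: `P_p(Rad_int(C(0)) ≥ r) ≥ e^{−r(p_c−p)/p}/(e(r+3))` for `0 < p ≤ p_c` and every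
`r`** — the chemical radius tail at `p = p_c − s` decays no faster than `e^{−rs/p}` times the critical power `1/r`: the intrinsic
correlation length is at least `p/s` ("`ν_int ≥ 1`"; mean field `ν_int = 1`).  No hypothesis.
[cite: Hutchcroft2022SlightlySupercritical, Prop. 4.2] -/
theorem real_far_subcritical_ge_exp (hd : 2 ≤ d) (r : ℕ) (p : unitInterval) (hp0 : 0 < (p : ℝ))
    (hpc : (p : ℝ) ≤ criticalProbI d) :
    Real.exp (-(r * (((criticalProbI d : ℝ) - p) / p))) / (Real.exp 1 * (r + 3)) ≤
      (bondPercolation (zdGraph d) p).real (far (zdGraph d) (0 : Site d) r) :=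
  le_trans (div_le_div_of_nonneg_right (exp_neg_le_div_pow hp0 hpc r) (by positivity))
    (real_far_subcritical_ge hd r p hp0 hpc)

/-! ### §3. At and above `p_c`, every `d ≥ 2`: `P_p(Rad_int ≥ r) ≥ max((1−p)/(e(r+3)), θ(p))` -/

/-- **`P_p(Rad_int(C(0)) ≥ r) ≥ (1−p)/(e(r+3))` for every `p ∈ (0,1)`, every `r`, every `d ≥ 2`** (the argument of file 3 at a
general `p`: `q = p(1 + (1−p)/(r+2))`, `(p/q)^r ≥ e^{−1}`, `θ(q) ≥ (q−p_c)/(q(1−p_c)) ≥ (q−p)/q ≥ (1−p)/(r+3)` when `q > p_c`; for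
`p ≥ p_c` this holds, which is the case of interest). [cite: Hutchcroft2022SlightlySupercritical, Prop. 4.2 (proof)] -/
theorem real_far_ge_of_ge_criticalProbI (hd : 2 ≤ d) (r : ℕ) (p : unitInterval) (hpc : (criticalProbI d : ℝ) ≤ p)
    (hp1 : (p : ℝ) < 1) :
    (1 - (p : ℝ)) / (Real.exp 1 * (r + 3)) ≤ (bondPercolation (zdGraph d) p).real (far (zdGraph d) (0 : Site d) r) := by
  have hd1 : 1 ≤ d := by omega
  set pc : ℝ := (criticalProbI d : ℝ) with hpcdef
  have hpc0 : 0 < pc := by rw [hpcdef, coe_criticalProbI]; exact criticalProb_zd_pos d hd1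
  have hpc1 : pc < 1 := by rw [hpcdef, coe_criticalProbI]; exact criticalProb_zd_lt_one hd
  set pp : ℝ := (p : ℝ) with hpp
  have hp0 : 0 < pp := hpc0.trans_le hpc
  have hr : (0 : ℝ) < r + 2 := by positivity
  set qr : ℝ := pp * (1 + (1 - pp) / (r + 2)) with hqr
  have hq_gt : pp < qr := by rw [hqr]; nlinarith [div_pos (by linarith : (0:ℝ) < 1 - pp) hr]
  have hq_lt : qr < 1 := by
    rw [hqr]
    have h1 : (1 - pp) / (r + 2) ≤ (1 - pp) := div_le_self (by linarith) (by linarith)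
    nlinarith
  let q : unitInterval := ⟨qr, (hp0.trans hq_gt).le, hq_lt.le⟩
  have hqv : (q : ℝ) = qr := rfl
  have hmain := pow_mul_theta_le_real_far (d := d) r p q hp0 (by rw [hqv]; exact hq_gt.le) (by rw [hqv]; exact hq_lt)
  -- `θ(q) ≥ (q - p_c)/(q(1 - p_c)) ≥ (q - p)/q ≥ (1 - p)/(r + 3)`
  have hθ : (1 - pp) / ((r : ℝ) + 3) ≤ theta (zdGraph d) 0 q := by
    have hmf := DCT16.perc_meanField_bound_holds hd q (by rw [hqv, ← coe_criticalProbI]; exact lt_of_le_of_lt hpc hq_gt)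
    rw [← coe_criticalProbI] at hmf
    refine le_trans ?_ hmf
    rw [hqv]
    have hq0 : 0 < qr := hp0.trans hq_gt
    calc (1 - pp) / ((r : ℝ) + 3) ≤ (qr - pp) / qr := by
          rw [div_le_div_iff₀ (by positivity) hq0]
          have key : (qr - pp) * ((r : ℝ) + 3) - (1 - pp) * qr = pp ^ 2 * (1 - pp) / (r + 2) := by
            rw [hqr]; field_simp; ring
          have : 0 ≤ pp ^ 2 * (1 - pp) / (r + 2) := div_nonneg (mul_nonneg (sq_nonneg _) (by linarith)) hr.le
          linarith
      _ ≤ (qr - pc) / (qr * (1 - pc)) := by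
          rw [div_le_div_iff₀ hq0 (mul_pos hq0 (by linarith))]
          have h1 : qr - pp ≤ qr - pc := by linarith
          have h2 : qr * (1 - pc) ≤ qr := by nlinarith
          nlinarith [mul_le_mul h1 (le_refl qr) hq0.le (by linarith : 0 ≤ qr - pc)]
  have hpow : Real.exp (-1) ≤ (pp / qr) ^ r := by
    have : pp / qr = 1 / (1 + (1 - pp) / (r + 2)) := by rw [hqr]; field_simp
    rw [this]; exact exp_neg_one_le_pow_div (by linarith) (by linarith) r
  calc (1 - pp) / (Real.exp 1 * (r + 3)) = Real.exp (-1) * ((1 - pp) / ((r : ℝ) + 3)) := by rw [Real.exp_neg]; field_simp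
    _ ≤ (pp / qr) ^ r * theta (zdGraph d) 0 q :=
        mul_le_mul hpow hθ (div_nonneg (by linarith) (by positivity)) (pow_nonneg (div_nonneg hp0.le (hp0.le.trans hq_gt.le)) r)
    _ ≤ _ := hmain

/-- **SUPERCRITICAL LOWER BOUND, every `d ≥ 2`: `P_p(Rad_int(C(0)) ≥ r) ≥ ((1−p)/(4e))·max(1/r, p − p_c)`** for `p_c ≤ p < 1`,
`r ≥ 1` (the two regimes: `(1−p)/(e(r+3)) ≥ (1−p)/(4er)` and `θ(p) ≥ (p−p_c)/(p(1−p_c)) ≥ p − p_c`). No hypothesis.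
[cite: Hutchcroft2022SlightlySupercritical, Prop. 4.2] [cite: DuminilCopinTassionEM2016, Thm. 1.1(2)] -/
theorem real_far_supercrit_ge_max (hd : 2 ≤ d) (r : ℕ) (hr : 1 ≤ r) (p : unitInterval)
    (hpc : (criticalProbI d : ℝ) ≤ p) (hp1 : (p : ℝ) < 1) :
    (1 - (p : ℝ)) / (4 * Real.exp 1) * max (1 / (r : ℝ)) ((p : ℝ) - criticalProbI d) ≤
      (bondPercolation (zdGraph d) p).real (far (zdGraph d) (0 : Site d) r) := by
  have hd1 : 1 ≤ d := by omega
  have hpc0 : 0 < (criticalProbI d : ℝ) := by rw [coe_criticalProbI]; exact criticalProb_zd_pos d hd1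
  have hpc1 : (criticalProbI d : ℝ) < 1 := by rw [coe_criticalProbI]; exact criticalProb_zd_lt_one hd
  have hr1 : (1 : ℝ) ≤ r := by exact_mod_cast hr
  have he : 1 ≤ Real.exp 1 := Real.one_le_exp zero_le_one
  have h1p : 0 < 1 - (p : ℝ) := by linarith
  rcases le_total (1 / (r : ℝ)) ((p : ℝ) - criticalProbI d) with h | h
  · -- thermal regime: use `θ(p)`
    rw [max_eq_right h]
    have hθ : (p : ℝ) - criticalProbI d ≤ theta (zdGraph d) 0 p := by
      have := sub_criticalProb_le_theta hd p (by rw [← coe_criticalProbI]; exact hpc)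
      rwa [← coe_criticalProbI] at this
    calc (1 - (p : ℝ)) / (4 * Real.exp 1) * ((p : ℝ) - criticalProbI d) ≤ 1 * ((p : ℝ) - criticalProbI d) := by
          refine mul_le_mul_of_nonneg_right ?_ (by linarith)
          rw [div_le_one (by positivity)]; linarith
      _ ≤ _ := by rw [one_mul]; exact hθ.trans (theta_le_real_far p r)
  · -- radius regime
    rw [max_eq_left h]
    calc (1 - (p : ℝ)) / (4 * Real.exp 1) * (1 / (r : ℝ)) = (1 - (p : ℝ)) / (Real.exp 1 * (4 * r)) := by
          field_simp
      _ ≤ (1 - (p : ℝ)) / (Real.exp 1 * (r + 3)) :=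
          div_le_div_of_nonneg_left h1p.le (by positivity) (by nlinarith)
      _ ≤ _ := real_far_ge_of_ge_criticalProbI hd r p hpc hp1

/-! ### §4. High dimensions: the LINEAR chemical window `P_{p_c+s}(Rad_int ≥ r) ≍ max(1/r, s)` -/

/-- `(p/p_c)^ℓ ≤ e²` when `ℓ (p − p_c) ≤ 2 p_c` (`p_c ≤ p`). [folklore] -/
theorem div_pow_le_exp_two {pc p : ℝ} (hpc0 : 0 < pc) (hpcp : pc ≤ p) {ℓ : ℕ} (hℓ : (ℓ : ℝ) * (p - pc) ≤ 2 * pc) :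
    (p / pc) ^ ℓ ≤ Real.exp 2 := by
  refine (div_pow_le_exp hpc0 hpcp ℓ).trans (Real.exp_le_exp.2 ?_)
  rw [mul_div_assoc', div_le_iff₀ hpc0]; linarith

/-- **SLIGHTLY SUPERCRITICAL UPPER BOUND under the triangle condition: `P_p(Rad_int(C(0)) ≥ r) ≤ C'·max(1/r, p − p_c)`** for all
`p_c ≤ p < 1`, `r ≥ 1` (Hutchcroft's Lemma 2.1, first bound, on `ℤ^d`): `P_p(far r) ≤ P_p(far ℓ) ≤ (p/p_c)^ℓ·C/ℓ` with
`ℓ = min(r, ⌈p_c/(p−p_c)⌉)`, `(p/p_c)^ℓ ≤ e²`, `1/ℓ ≤ max(1/r, p−p_c)/p_c`; `C' = max(e²C, 1)/p_c`.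
[cite: Hutchcroft2022SlightlySupercritical, Lemma 2.1] [cite: KozmaNachmias2009, §1.3 Thm. 1.2(ii)] -/
theorem real_far_supercrit_le_max_of_triangle (hd : 2 ≤ d) (hT : TriangleCondition d) :
    ∃ C' : ℝ, 0 < C' ∧ ∀ p : unitInterval, (criticalProbI d : ℝ) ≤ p → (p : ℝ) < 1 → ∀ r : ℕ, 1 ≤ r →
      (bondPercolation (zdGraph d) p).real (far (zdGraph d) (0 : Site d) r) ≤
        C' * max (1 / (r : ℝ)) ((p : ℝ) - criticalProbI d) := by
  have hd1 : 1 ≤ d := by omega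
  obtain ⟨C, hC, hfar⟩ := real_far_criticalProbI_le_of_triangle hd hT
  set pc : ℝ := (criticalProbI d : ℝ) with hpcdef
  have hpc0 : 0 < pc := by rw [hpcdef, coe_criticalProbI]; exact criticalProb_zd_pos d hd1
  have hpc1 : pc < 1 := by rw [hpcdef, coe_criticalProbI]; exact criticalProb_zd_lt_one hd
  set M : ℝ := max (Real.exp 2 * C) 1 with hM
  have hM1 : 1 ≤ M := le_max_right _ _
  have hMC : Real.exp 2 * C ≤ M := le_max_left _ _
  refine ⟨M / pc, by positivity, fun p hpc hp1 r hr => ?_⟩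
  set s : ℝ := (p : ℝ) - pc with hs
  set X : ℝ := max (1 / (r : ℝ)) s with hX
  have hs0 : 0 ≤ s := by rw [hs]; linarith
  have hr0 : (0 : ℝ) < r := by exact_mod_cast hr
  have hX0 : 0 ≤ X := le_max_of_le_left (by positivity)
  have hXs : s ≤ X := le_max_right _ _
  have hXr : 1 / (r : ℝ) ≤ X := le_max_left _ _
  have hP1 : (bondPercolation (zdGraph d) p).real (far (zdGraph d) (0 : Site d) r) ≤ 1 := measureReal_le_one
  -- regime `s ≥ p_c`: the bound is `≥ 1`
  by_cases hbig : pc ≤ s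
  · refine hP1.trans ?_
    calc (1 : ℝ) ≤ 1 / pc * s := by rw [div_mul_eq_mul_div, one_mul, le_div_iff₀ hpc0]; linarith
      _ ≤ M / pc * X := mul_le_mul (div_le_div_of_nonneg_right hM1 hpc0.le) hXs hs0 (by positivity)
  push Not at hbig
  rcases hs0.eq_or_lt with hs00 | hs_pos
  · -- `s = 0`: `P_p = P_{p_c} ≤ C/r`
    have hppc : p = criticalProbI d := Subtype.ext (by
      have : (p : ℝ) - pc = 0 := by rw [← hs]; exact hs00.symm
      rw [hpcdef] at this; linarith)
    rw [hppc]
    calc (bondPercolation (zdGraph d) (criticalProbI d)).real (far (zdGraph d) (0 : Site d) r)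
        ≤ C * (r : ℝ) ^ (-(1 : ℝ)) := hfar r hr
      _ = C * (1 / r) := by rw [Real.rpow_neg_one, one_div]
      _ ≤ M / pc * X := by
          refine mul_le_mul ?_ hXr (by positivity) (by positivity)
          calc C ≤ Real.exp 2 * C := le_mul_of_one_le_left hC.le (Real.one_le_exp (by norm_num))
            _ ≤ M := hMC
            _ ≤ M / pc := le_div_self (by positivity) hpc0 hpc1.le
  -- main regime `0 < s < p_c`: `ℓ = min r ⌈p_c/s⌉`
  set ℓ : ℕ := min r ⌈pc / s⌉₊ with hℓ
  have hceil1 : 1 ≤ ⌈pc / s⌉₊ := Nat.ceil_pos.2 (div_pos hpc0 hs_pos)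
  have hℓ1 : 1 ≤ ℓ := le_min hr hceil1
  have hℓr : ℓ ≤ r := min_le_left _ _
  have hℓ0 : (0 : ℝ) < ℓ := by exact_mod_cast hℓ1
  have hℓs : (ℓ : ℝ) * s ≤ 2 * pc := by
    have h1 : (ℓ : ℝ) ≤ ⌈pc / s⌉₊ := by exact_mod_cast min_le_right _ _
    have h2 : (⌈pc / s⌉₊ : ℝ) ≤ pc / s + 1 := (Nat.ceil_lt_add_one (div_pos hpc0 hs_pos).le).le
    calc (ℓ : ℝ) * s ≤ (pc / s + 1) * s := mul_le_mul_of_nonneg_right (h1.trans h2) hs0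
      _ = pc + s := by field_simp
      _ ≤ 2 * pc := by linarith
  -- `1/ℓ ≤ X/p_c`
  have hinvℓ : 1 / (ℓ : ℝ) ≤ X / pc := by
    rcases le_total r ⌈pc / s⌉₊ with hmin | hmin
    · have hℓeq : ℓ = r := min_eq_left hmin
      rw [hℓeq]
      exact hXr.trans (le_div_self hX0 hpc0 hpc1.le)
    · have hℓeq : ℓ = ⌈pc / s⌉₊ := min_eq_right hmin
      rw [hℓeq]
      calc 1 / (⌈pc / s⌉₊ : ℝ) ≤ s / pc := by
            rw [div_le_div_iff₀ (by exact_mod_cast hceil1 : (0 : ℝ) < ⌈pc / s⌉₊) hpc0, one_mul]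
            have := Nat.le_ceil (pc / s)
            rw [div_le_iff₀ hs_pos] at this
            linarith
        _ ≤ X / pc := div_le_div_of_nonneg_right hXs hpc0.le
  have hstep1 : (bondPercolation (zdGraph d) p).real (far (zdGraph d) (0 : Site d) r) ≤
      (bondPercolation (zdGraph d) p).real (far (zdGraph d) (0 : Site d) ℓ) :=
    measureReal_mono (far_antitone (zdGraph d) 0 hℓr) (measure_ne_top _ _)
  have hstep2 : (bondPercolation (zdGraph d) p).real (far (zdGraph d) (0 : Site d) ℓ) ≤
      ((p : ℝ) / pc) ^ ℓ * (C * (ℓ : ℝ) ^ (-(1 : ℝ))) :=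
    (real_far_le_pow_mul_real_far ℓ (criticalProbI d) p hpc0 hpc hp1).trans
      (mul_le_mul_of_nonneg_left (hfar ℓ hℓ1) (pow_nonneg (div_nonneg (hpc0.le.trans hpc) hpc0.le) ℓ))
  have hgrow : ((p : ℝ) / pc) ^ ℓ ≤ Real.exp 2 := div_pow_le_exp_two hpc0 hpc (by rw [← hs]; exact hℓs)
  calc (bondPercolation (zdGraph d) p).real (far (zdGraph d) (0 : Site d) r)
      ≤ ((p : ℝ) / pc) ^ ℓ * (C * (ℓ : ℝ) ^ (-(1 : ℝ))) := hstep1.trans hstep2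
    _ = ((p : ℝ) / pc) ^ ℓ * (C * (1 / ℓ)) := by rw [Real.rpow_neg_one, one_div]
    _ ≤ Real.exp 2 * (C * (X / pc)) :=
        mul_le_mul hgrow (mul_le_mul_of_nonneg_left hinvℓ hC.le) (by positivity) (by positivity)
    _ = (Real.exp 2 * C) / pc * X := by ring
    _ ≤ M / pc * X := mul_le_mul_of_nonneg_right (div_le_div_of_nonneg_right hMC hpc0.le) hX0

/-- **THE LINEAR CHEMICAL WINDOW, two-sided under the triangle condition: `c·max(1/r, p−p_c) ≤ P_p(Rad_int(C(0)) ≥ r) ≤ C'·max(1/r, p−p_c)`**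
for `p_c ≤ p ≤ (1+p_c)/2`, `r ≥ 1` (`c = (1−p_c)/(8e)` hypothesis-free; `C'` from `real_far_supercrit_le_max_of_triangle`): the chemical
one-arm crosses over from `≍ 1/r` to `θ(p) ≍ p − p_c` at `r ≍ 1/(p−p_c)`. [cite: Hutchcroft2022SlightlySupercritical, Lemma 2.1, Prop. 4.2] -/
theorem real_far_supercrit_two_sided_of_triangle (hd : 2 ≤ d) (hT : TriangleCondition d) :
    ∃ c C' : ℝ, 0 < c ∧ 0 < C' ∧ ∀ p : unitInterval, (criticalProbI d : ℝ) ≤ p → (p : ℝ) ≤ (1 + criticalProbI d) / 2 →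
      ∀ r : ℕ, 1 ≤ r →
        c * max (1 / (r : ℝ)) ((p : ℝ) - criticalProbI d) ≤ (bondPercolation (zdGraph d) p).real (far (zdGraph d) (0 : Site d) r) ∧
        (bondPercolation (zdGraph d) p).real (far (zdGraph d) (0 : Site d) r) ≤ C' * max (1 / (r : ℝ)) ((p : ℝ) - criticalProbI d) := by
  have hpc1 : (criticalProbI d : ℝ) < 1 := by rw [coe_criticalProbI]; exact criticalProb_zd_lt_one hd
  obtain ⟨C', hC', hup⟩ := real_far_supercrit_le_max_of_triangle hd hT
  have h1pc : 0 < 1 - (criticalProbI d : ℝ) := by linarith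
  have hc0 : 0 < (1 - (criticalProbI d : ℝ)) / (8 * Real.exp 1) := by positivity
  refine ⟨(1 - criticalProbI d) / (8 * Real.exp 1), C', hc0, hC', fun p hpc hpmid r hr => ⟨?_, hup p hpc (by linarith) r hr⟩⟩
  have hr0 : (0 : ℝ) < r := by exact_mod_cast hr
  have hmax0 : 0 ≤ max (1 / (r : ℝ)) ((p : ℝ) - criticalProbI d) := le_max_of_le_left (by positivity)
  refine le_trans (mul_le_mul_of_nonneg_right ?_ hmax0) (real_far_supercrit_ge_max hd r hr p hpc (by linarith))
  rw [div_le_div_iff₀ (by positivity) (by positivity)]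
  nlinarith [Real.exp_pos 1]

/-- **HIGH DIMENSIONS, unconditionally: `∃ D > 6, ∀ d ≥ D`, the slightly supercritical chemical one-arm probability satisfies
`c_d·max(1/r, p−p_c) ≤ P_p(Rad_int(C(0)) ≥ r) ≤ C_d·max(1/r, p−p_c)` for `p_c ≤ p ≤ (1+p_c)/2`, `r ≥ 1`** (triangle condition for `d ≥ D`:
`HaraSlade1990_triangleCondition_holds`). [cite: Hutchcroft2022SlightlySupercritical, Lemma 2.1] [cite: KozmaNachmias2009, §1.3 Thm. 1.2(ii)] -/
theorem real_far_supercrit_two_sided_high_dim :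
    ∃ D : ℕ, 6 < D ∧ ∀ d : ℕ, D ≤ d → ∃ c C' : ℝ, 0 < c ∧ 0 < C' ∧
      ∀ p : unitInterval, (criticalProbI d : ℝ) ≤ p → (p : ℝ) ≤ (1 + criticalProbI d) / 2 → ∀ r : ℕ, 1 ≤ r →
        c * max (1 / (r : ℝ)) ((p : ℝ) - criticalProbI d) ≤ (bondPercolation (zdGraph d) p).real (far (zdGraph d) (0 : Site d) r) ∧
        (bondPercolation (zdGraph d) p).real (far (zdGraph d) (0 : Site d) r) ≤ C' * max (1 / (r : ℝ)) ((p : ℝ) - criticalProbI d) := by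
  obtain ⟨D, hD, hT⟩ := Literature.Barriers.CriticalPhenomena.HaraSlade1990_triangleCondition_holds
  exact ⟨D, hD, fun d hd => real_far_supercrit_two_sided_of_triangle (by omega) (hT d hd)⟩

/-! ### §5. A dimension-free floor for the critical VOLUME tail: `P_{p_c}(|C(0)| ≥ k) ≥ 1/(e(k+2))` -/

/-- `{∂B(v, r; K) ≠ ∅} ⊆ {|C(v)| ≥ r+1}`: the vertices of a geodesic of length `≥ r` are `r+1` distinct sites of the cluster.
[cite: KozmaNachmias2009, §1.3 (intrinsic vs extrinsic balls)] -/
theorem far_subset_clusterSizeGe {V : Type*} (K : SimpleGraph V) (v : V) (r : ℕ) :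
    far K v r ⊆ clusterSizeGe v (r + 1) := by
  rintro ω ⟨z, hz, hrz⟩
  obtain ⟨w, hw⟩ := hz.exists_walk_length_eq_dist
  rw [mem_clusterSizeGe]
  have hmaps : Set.MapsTo (fun i : ℕ => w.getVert i) (↑(Finset.range (r + 1)) : Set ℕ) (openCluster ω v) := by
    intro i _
    exact SimpleGraph.Reachable.mono inf_le_left ⟨w.take i⟩
  have hinj : Set.InjOn (fun i : ℕ => w.getVert i) (↑(Finset.range (r + 1)) : Set ℕ) := by
    intro i hi j hj hij
    have hi' : i ≤ w.length := by rw [Finset.coe_range, Set.mem_Iio] at hi; omega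
    have hj' : j ≤ w.length := by rw [Finset.coe_range, Set.mem_Iio] at hj; omega
    have h1 := dist_getVert_of_length_eq_dist w hw hi'
    have h2 := dist_getVert_of_length_eq_dist w hw hj'
    dsimp only at hij
    rw [hij] at h1
    exact h1.symm.trans h2
  have h := Set.encard_le_encard_of_injOn hmaps hinj
  rw [Set.encard_coe_eq_coe_finsetCard, Finset.card_range] at h
  exact_mod_cast h

/-- **A DIMENSION-FREE FLOOR FOR THE CRITICAL CLUSTER-SIZE TAIL: `P_{p_c}(|C(0)| ≥ k) ≥ 1/(e(k+2))` for every `k ≥ 1`, every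
`d ≥ 2`** (chemical radius `≥ k−1` forces `k` sites; the tree's product floor `a_k·E[|C|∧k] ≥ p_c(1−p_c)/(256d)` gives the
same order `1/k` with a `d`-dependent constant; mean field `≍ k^{−1/2}`, so not sharp — but universal). No hypothesis.
[cite: Hutchcroft2022SlightlySupercritical, Prop. 4.2] -/
theorem real_clusterSizeGe_criticalProbI_ge (hd : 2 ≤ d) (k : ℕ) (hk : 1 ≤ k) :
    1 / (Real.exp 1 * (k + 2)) ≤ (bondPercolation (zdGraph d) (criticalProbI d)).real (clusterSizeGe (0 : Site d) k) := by
  obtain ⟨r, rfl⟩ : ∃ r, k = r + 1 := ⟨k - 1, by omega⟩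
  refine le_trans (le_of_eq ?_) ((real_far_criticalProbI_ge hd r).trans
    (measureReal_mono (far_subset_clusterSizeGe (zdGraph d) 0 r) (measure_ne_top _ _)))
  push_cast; ring

/-- **Subcritical dimension-free floor: `P_p(|C(0)| ≥ k) ≥ e^{−(k−1)(p_c−p)/p}/(e(k+2))`** for `0 < p ≤ p_c`, `k ≥ 1`, every `d ≥ 2`.
[cite: Hutchcroft2022SlightlySupercritical, Prop. 4.2] -/
theorem real_clusterSizeGe_subcritical_ge (hd : 2 ≤ d) (k : ℕ) (hk : 1 ≤ k) (p : unitInterval) (hp0 : 0 < (p : ℝ))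
    (hpc : (p : ℝ) ≤ criticalProbI d) :
    Real.exp (-((((k - 1 : ℕ) : ℝ)) * (((criticalProbI d : ℝ) - p) / p))) / (Real.exp 1 * (k + 2)) ≤
      (bondPercolation (zdGraph d) p).real (clusterSizeGe (0 : Site d) k) := by
  obtain ⟨r, rfl⟩ : ∃ r, k = r + 1 := ⟨k - 1, by omega⟩
  have h := (real_far_subcritical_ge_exp hd r p hp0 hpc).trans
    (measureReal_mono (far_subset_clusterSizeGe (zdGraph d) 0 r) (measure_ne_top _ _))
  refine le_trans (le_of_eq ?_) h
  rw [Nat.add_sub_cancel]; push_cast; ring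


end ChemRad

end Summit.CriticalPhenomena.PercolationContinuityZ3.Theorems

end
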